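import Literature.NumberTheory.LFunctions.SelbergDeltaExplicit
import Literature.NumberTheory.LFunctions.SelbergDeltaSSide
import Literature.NumberTheory.LFunctions.SelbergFujiiMoments
import HarnessLib

/-!
# `S(t+h) − S(t)` smoothed on `[T, 2T]`: the pointwise main inequality

Topic `Literature/NumberTheory/LFunctions`. Everything in this file is PROVED (no definitions, no
named facts).

Combining the integrated explicit formula (`SelbergDeltaExplicit.lean`) with the counting side
(`SelbergDeltaSSide.lean`): for `T ≥ 200`, `0 ≤ h ≤ 1`, `τ ≥ 1` and `u ∈ [9T/8, 15T/8]`,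

  `|Re (𝒱_τ(u+h) − 𝒱_τ(u))| ≤ |∫_T^{2T} K_τ(t−u) (S(t+h) − S(t)) dt| + ‖∑_ρ m(ρ)(𝒜_ρ(u+h) − 𝒜_ρ(u))‖ + E`,

with `E = O(h (log T)/(τ √T) + h e^{τ/8}/(τ T²) + h/(τ³ T²))` explicit (`main_pointwise`): the prime
polynomial is dominated by the smoothed `S(t+h) − S(t)`, the off-line sum, and negligible terms
(Titchmarsh §9.26; Selberg 1946 §§5–7; Fujii 1975).

Also: `∑_ρ m(ρ)/(1 + γ²) < ∞` (`summable_zeroOrder_div_one_add_im_sq`) and the absolute convergence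
of the off-line sum (`summable_offA_sub`).

## References

* E. C. Titchmarsh, *The Theory of the Riemann Zeta-Function*, 2nd ed. (1986), §9.26.
  [cite: Titchmarsh1986, §9.26]
* A. Selberg, *Contributions to the theory of the Riemann zeta-function* (1946), §§5–7.
* K.-M. Tsang, *Some Ω-theorems for the Riemann zeta-function*, Acta Arith. 46 (1986), Lemma 5.
-/

noncomputable section

open Complex Real MeasureTheory Set Filter intervalIntegral
open scoped Topology ComplexConjugate

namespace Literature.NumberTheory.LFunctions.SelbergDelta

open Literature.NumberTheory.LFunctions.SelbergOmega
open Literature.NumberTheory.LFunctions.ZeroOrdinateSums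

/-! ### `∑ m(ρ)/(1 + γ²) < ∞` -/

/-- Weight comparison: if `z` has the ordinate and multiplicity of `ρ` and `(Re z)² ≤ 1` then
`m(ρ)/(1+γ²) ≤ m(z)/‖z‖²`. [folklore] -/
theorem div_one_add_sq_le_div_norm_sq {ρ z : ℂ} (hρ : ρ ∈ ZetaZeros.riemannZetaNontrivialZeros)
    (him : z.im = ρ.im) (hre : z.re ^ 2 ≤ 1) (hm : riemannZetaZeroOrder z = riemannZetaZeroOrder ρ) :
    (riemannZetaZeroOrder ρ : ℝ) / (1 + ρ.im ^ 2) ≤ (riemannZetaZeroOrder z : ℝ) / ‖z‖ ^ 2 := by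
  have hm0 : (0 : ℝ) ≤ riemannZetaZeroOrder ρ := by
    exact_mod_cast riemannZetaZeroOrder_nonneg (ZetaZeros.riemannZetaNontrivialZeros.ne_one hρ)
  have hz : z ≠ 0 := by
    intro hz; rw [hz, Complex.zero_im] at him
    exact ZetaZeros.riemannZetaNontrivialZeros.im_ne_zero hρ him.symm
  have hz2 : 0 < ‖z‖ ^ 2 := by positivity
  rw [hm]
  refine div_le_div_of_nonneg_left hm0 hz2 ?_
  rw [← Complex.normSq_eq_norm_sq, Complex.normSq_apply, him]
  nlinarith

/-- **`∑_{ρ} m(ρ)/(1 + γ²) < ∞`** over the non-trivial zeros (from `∑ m(ρ)/|ρ|² < ∞` over the zeros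
with `β ≥ 1/4`, `Literature.NumberTheory.LFunctions.summable_zeroOrder_div_norm_sq`, and the
reflection `ρ ↦ 1 − ρ̄`). [cite: Titchmarsh1986, §9.2, Thm. 9.2] -/
theorem summable_zeroOrder_div_one_add_im_sq :
    Summable fun ρ : ZetaZeros.riemannZetaNontrivialZeros => (riemannZetaZeroOrder (ρ : ℂ) : ℝ) / (1 + (ρ : ℂ).im ^ 2) := by
  have hG := summable_zeroOrder_div_norm_sq
  have hζ : ∀ ρ : ZetaZeros.riemannZetaNontrivialZeros, riemannZeta ρ = 0 := fun ρ =>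
    ZetaZeros.riemannZetaNontrivialZeros.zeta_eq_zero ρ.2
  have hnn : ∀ ρ : ZetaZeros.riemannZetaNontrivialZeros, 0 ≤ (riemannZetaZeroOrder (ρ : ℂ) : ℝ) / (1 + (ρ : ℂ).im ^ 2) :=
    fun ρ => div_nonneg (by exact_mod_cast riemannZetaZeroOrder_nonneg (ZetaZeros.riemannZetaNontrivialZeros.ne_one ρ.2))
      (by positivity)
  set s : Set ZetaZeros.riemannZetaNontrivialZeros := {ρ | 1 / 4 ≤ (ρ : ℂ).re} with hs
  refine (summable_subtype_and_compl (s := s)).1 ⟨?_, ?_⟩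
  · let i₁ : s → zetaZerosRight := fun ρ =>
      ⟨((ρ : ZetaZeros.riemannZetaNontrivialZeros) : ℂ), hζ (ρ : ZetaZeros.riemannZetaNontrivialZeros), ρ.2⟩
    have hi₁ : Function.Injective i₁ := by
      intro a b hab
      have h := congrArg Subtype.val hab
      exact Subtype.ext (Subtype.ext h)
    refine Summable.of_nonneg_of_le (fun ρ => hnn _) (fun ρ => ?_) (hG.comp_injective hi₁)
    have h1 : ((ρ : ZetaZeros.riemannZetaNontrivialZeros) : ℂ).re ^ 2 ≤ 1 := by
      have h0 := ZetaZeros.riemannZetaNontrivialZeros.re_pos (ρ : ZetaZeros.riemannZetaNontrivialZeros).2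
      have h1 := ZetaZeros.riemannZetaNontrivialZeros.re_lt_one (ρ : ZetaZeros.riemannZetaNontrivialZeros).2
      nlinarith
    exact div_one_add_sq_le_div_norm_sq (ρ : ZetaZeros.riemannZetaNontrivialZeros).2 rfl h1 rfl
  · have hmem : ∀ ρ : ↥sᶜ, riemannZeta (1 - conj ((ρ : ZetaZeros.riemannZetaNontrivialZeros) : ℂ)) = 0 ∧
        1 / 4 ≤ (1 - conj ((ρ : ZetaZeros.riemannZetaNontrivialZeros) : ℂ)).re := by
      intro ρ
      have hρ := (ρ : ZetaZeros.riemannZetaNontrivialZeros).2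
      have hlt : ¬ 1 / 4 ≤ ((ρ : ZetaZeros.riemannZetaNontrivialZeros) : ℂ).re := ρ.2
      refine ⟨ZetaZeros.riemannZetaNontrivialZeros.zeta_eq_zero
        (ZetaZeros.riemannZetaNontrivialZeros.one_sub_conj_mem hρ), ?_⟩
      simp only [sub_re, one_re, conj_re]
      linarith
    let i₂ : ↥sᶜ → zetaZerosRight := fun ρ =>
      ⟨1 - conj ((ρ : ZetaZeros.riemannZetaNontrivialZeros) : ℂ), hmem ρ⟩
    have hi₂ : Function.Injective i₂ := by
      intro a b hab
      have h : 1 - conj ((a : ZetaZeros.riemannZetaNontrivialZeros) : ℂ) =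
          1 - conj ((b : ZetaZeros.riemannZetaNontrivialZeros) : ℂ) := congrArg Subtype.val hab
      have h' : ((a : ZetaZeros.riemannZetaNontrivialZeros) : ℂ) = ((b : ZetaZeros.riemannZetaNontrivialZeros) : ℂ) := by
        have := congrArg conj (sub_right_injective h)
        simpa using this
      exact Subtype.ext (Subtype.ext h')
    refine Summable.of_nonneg_of_le (fun ρ => hnn _) (fun ρ => ?_) (hG.comp_injective hi₂)
    have hρ := (ρ : ZetaZeros.riemannZetaNontrivialZeros).2
    have h0 := ZetaZeros.riemannZetaNontrivialZeros.re_pos hρ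
    have h1 := ZetaZeros.riemannZetaNontrivialZeros.re_lt_one hρ
    refine div_one_add_sq_le_div_norm_sq hρ (by simp [i₂]) ?_ (riemannZetaZeroOrder_one_sub_conj h0 h1)
    simp only [i₂, sub_re, one_re, conj_re]
    nlinarith

/-- Shifted form: `∑ m(ρ)/(1 + (γ − t)²) < ∞` for every real `t`. [folklore] -/
theorem summable_zeroOrder_div_one_add_sub_sq (t : ℝ) :
    Summable fun ρ : ZetaZeros.riemannZetaNontrivialZeros => (riemannZetaZeroOrder (ρ : ℂ) : ℝ) / (1 + ((ρ : ℂ).im - t) ^ 2) := by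
  refine Summable.of_nonneg_of_le (fun ρ => ?_) (fun ρ => ?_) (summable_zeroOrder_div_one_add_im_sq.mul_left (2 * (1 + t ^ 2)))
  · exact div_nonneg (riemannZetaZeroOrder_nonneg_of_zero (ZetaZeros.riemannZetaNontrivialZeros.zeta_eq_zero ρ.2)) (by positivity)
  · have hm := riemannZetaZeroOrder_nonneg_of_zero (ZetaZeros.riemannZetaNontrivialZeros.zeta_eq_zero ρ.2)
    have h := one_add_sq_le_two_mul (ρ : ℂ).im t
    rw [mul_div_assoc', div_le_div_iff₀ (by positivity) (by positivity)]
    calc (riemannZetaZeroOrder (ρ : ℂ) : ℝ) * (1 + (ρ : ℂ).im ^ 2)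
        ≤ (riemannZetaZeroOrder (ρ : ℂ) : ℝ) * (2 * (1 + ((ρ : ℂ).im - t) ^ 2) * (1 + t ^ 2)) := mul_le_mul_of_nonneg_left h hm
      _ = 2 * (1 + t ^ 2) * (riemannZetaZeroOrder (ρ : ℂ) : ℝ) * (1 + ((ρ : ℂ).im - t) ^ 2) := by ring

/-! ### The off-line sum converges absolutely -/

/-- `‖𝒜_ρ(t)‖ ≤ (τ/2) e^{τ/8} D₀ /(1 + (γ − t)²)` for a non-trivial zero `ρ` and `τ ≥ 1`. [folklore] -/
theorem norm_offA_le' {τ : ℝ} (hτ : 1 ≤ τ) {ρ : ℂ} (hρ : ρ ∈ ZetaZeros.riemannZetaNontrivialZeros) (t : ℝ) :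
    ‖offA τ ρ t‖ ≤ τ / 2 * Real.exp (τ / 8) * decayD0 / (1 + (ρ.im - t) ^ 2) := by
  have hτ0 : 0 < τ := by linarith
  have h := norm_offA_le hτ0 ρ t
  have h0 := ZetaZeros.riemannZetaNontrivialZeros.re_pos hρ
  have h1 := ZetaZeros.riemannZetaNontrivialZeros.re_lt_one hρ
  have hδ : |ρ.re - 1 / 2| ≤ 1 / 2 := abs_le.2 ⟨by linarith, by linarith⟩
  have hD := decayD0_nonneg
  refine h.trans ?_
  have hexp : Real.exp (τ * |ρ.re - 1 / 2| / 4) ≤ Real.exp (τ / 8) := Real.exp_le_exp.2 (by nlinarith)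
  have hden : 1 + (ρ.im - t) ^ 2 ≤ 1 + (τ * (ρ.im - t)) ^ 2 := by
    rw [mul_pow]; nlinarith [sq_nonneg (ρ.im - t), show 1 ≤ τ ^ 2 by nlinarith]
  have hpos : 0 < 1 + (ρ.im - t) ^ 2 := by positivity
  calc |ρ.re - 1 / 2| * (τ * Real.exp (τ * |ρ.re - 1 / 2| / 4) * decayD0 / (1 + (τ * (ρ.im - t)) ^ 2))
      ≤ 1 / 2 * (τ * Real.exp (τ / 8) * decayD0 / (1 + (ρ.im - t) ^ 2)) := by
        refine mul_le_mul hδ ?_ (by positivity) (by norm_num)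
        calc τ * Real.exp (τ * |ρ.re - 1 / 2| / 4) * decayD0 / (1 + (τ * (ρ.im - t)) ^ 2)
            ≤ τ * Real.exp (τ / 8) * decayD0 / (1 + (τ * (ρ.im - t)) ^ 2) := by gcongr
          _ ≤ τ * Real.exp (τ / 8) * decayD0 / (1 + (ρ.im - t) ^ 2) :=
              div_le_div_of_nonneg_left (by positivity) hpos hden
    _ = _ := by ring

/-- **The off-line sum converges absolutely**: `∑ ‖m(ρ)(𝒜_ρ(u+h) − 𝒜_ρ(u))‖ < ∞` (`τ ≥ 1`). [folklore] -/
theorem summable_norm_offA_sub {τ : ℝ} (hτ : 1 ≤ τ) (u h : ℝ) :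
    Summable fun ρ : ZetaZeros.riemannZetaNontrivialZeros =>
      ‖(riemannZetaZeroOrder (ρ : ℂ) : ℂ) * (offA τ ρ (u + h) - offA τ ρ u)‖ := by
  set K := τ / 2 * Real.exp (τ / 8) * decayD0 with hK
  have hK0 : 0 ≤ K := by rw [hK]; have := decayD0_nonneg; positivity
  have hs := ((summable_zeroOrder_div_one_add_sub_sq (u + h)).add (summable_zeroOrder_div_one_add_sub_sq u)).mul_left K
  refine Summable.of_nonneg_of_le (fun _ => norm_nonneg _) (fun ρ => ?_) hs
  have hm : (0 : ℝ) ≤ riemannZetaZeroOrder (ρ : ℂ) :=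
    riemannZetaZeroOrder_nonneg_of_zero (ZetaZeros.riemannZetaNontrivialZeros.zeta_eq_zero ρ.2)
  rw [norm_mul, Complex.norm_intCast, abs_of_nonneg hm]
  have h1 := norm_offA_le' hτ ρ.2 (u + h)
  have h2 := norm_offA_le' hτ ρ.2 u
  calc (riemannZetaZeroOrder (ρ : ℂ) : ℝ) * ‖offA τ ρ (u + h) - offA τ ρ u‖
      ≤ (riemannZetaZeroOrder (ρ : ℂ) : ℝ) * (K / (1 + ((ρ : ℂ).im - (u + h)) ^ 2) + K / (1 + ((ρ : ℂ).im - u) ^ 2)) := by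
        refine mul_le_mul_of_nonneg_left ((norm_sub_le _ _).trans (add_le_add h1 h2)) hm
    _ = K * ((riemannZetaZeroOrder (ρ : ℂ) : ℝ) / (1 + ((ρ : ℂ).im - (u + h)) ^ 2) +
          (riemannZetaZeroOrder (ρ : ℂ) : ℝ) / (1 + ((ρ : ℂ).im - u) ^ 2)) := by ring

/-- The off-line sum converges. [folklore] -/
theorem summable_offA_sub {τ : ℝ} (hτ : 1 ≤ τ) (u h : ℝ) :
    Summable fun ρ : ZetaZeros.riemannZetaNontrivialZeros =>
      (riemannZetaZeroOrder (ρ : ℂ) : ℂ) * (offA τ ρ (u + h) - offA τ ρ u) :=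
  (summable_norm_offA_sub hτ u h).of_norm

/-! ### The counting-side decomposition of the smoothed `S(t+h) − S(t)` -/

/-- Interval integrability of `t ↦ N(t+h) − N(t)`. [folklore] -/
theorem intervalIntegrable_deltaN (h a b : ℝ) :
    IntervalIntegrable (fun t : ℝ => (zetaZeroCount (t + h) : ℝ) - zetaZeroCount t) volume a b := by
  have h1 : IntervalIntegrable (fun t : ℝ => (zetaZeroCount (t + h) : ℝ)) volume a b :=
    Monotone.intervalIntegrable fun x y hxy => Nat.cast_le.2 (zetaZeroCount_mono (by linarith))
  have h2 : IntervalIntegrable (fun t : ℝ => (zetaZeroCount t : ℝ)) volume a b :=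
    Monotone.intervalIntegrable fun x y hxy => Nat.cast_le.2 (zetaZeroCount_mono hxy)
  exact h1.sub h2

/-- Interval integrability of `t ↦ S(t+h) − S(t)`. [folklore] -/
theorem intervalIntegrable_deltaS (h a b : ℝ) :
    IntervalIntegrable (fun t : ℝ => zetaArgS (t + h) - zetaArgS t) volume a b := by
  have hθc : Continuous riemannSiegelTheta :=
    continuous_iff_continuousAt.2 fun t => (hasDerivAt_riemannSiegelTheta_holds t).continuousAt
  have h1 := intervalIntegrable_deltaN h a b
  have h2 : IntervalIntegrable (fun t : ℝ => (riemannSiegelTheta (t + h) - riemannSiegelTheta t) / π) volume a b :=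
    (((hθc.comp (continuous_id.add continuous_const)).sub hθc).div_const π).intervalIntegrable _ _
  refine (h1.sub h2).congr ?_
  intro t _
  simp only [SelbergFujii.zetaArgS_sub]

/-- `K_τ ⋆_T ΔS = K_τ ⋆_T ΔN − (1/π) K_τ ⋆_T Δθ`. [folklore] -/
theorem conv_deltaS_eq (τ u T h : ℝ) :
    ∫ t in T..2 * T, kerDil τ (t - u) * (zetaArgS (t + h) - zetaArgS t) =
      (∫ t in T..2 * T, kerDil τ (t - u) * ((zetaZeroCount (t + h) : ℝ) - zetaZeroCount t)) -
        (1 / π) * ∫ t in T..2 * T, kerDil τ (t - u) * (riemannSiegelTheta (t + h) - riemannSiegelTheta t) := by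
  have hθc : Continuous riemannSiegelTheta :=
    continuous_iff_continuousAt.2 fun t => (hasDerivAt_riemannSiegelTheta_holds t).continuousAt
  have hK : Continuous fun t : ℝ => kerDil τ (t - u) := (continuous_kerDil τ).comp (by fun_prop)
  have h1 : IntervalIntegrable (fun t : ℝ => kerDil τ (t - u) * ((zetaZeroCount (t + h) : ℝ) - zetaZeroCount t)) volume T (2 * T) :=
    (intervalIntegrable_deltaN h T (2 * T)).continuousOn_mul hK.continuousOn
  have h2 : IntervalIntegrable (fun t : ℝ => kerDil τ (t - u) * (riemannSiegelTheta (t + h) - riemannSiegelTheta t)) volume T (2 * T) :=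
    (hK.mul ((hθc.comp (continuous_id.add continuous_const)).sub hθc)).intervalIntegrable _ _
  rw [← intervalIntegral.integral_const_mul, ← intervalIntegral.integral_sub h1 (h2.const_mul _)]
  refine intervalIntegral.integral_congr fun t _ => ?_
  simp only [SelbergFujii.zetaArgS_sub]; ring

/-! ### The pointwise main inequality -/

/-- **The pointwise main inequality** (Titchmarsh §9.26 in smoothed form): there is `E > 0` such that
for `T ≥ 200`, `0 ≤ h ≤ 1`, `τ ≥ 1` and `u ∈ [9T/8, 15T/8]`,
`|Re(𝒱_τ(u+h) − 𝒱_τ(u))| ≤ |∫_T^{2T} K_τ(t−u)(S(t+h) − S(t)) dt| + ‖∑_ρ m(ρ)(𝒜_ρ(u+h) − 𝒜_ρ(u))‖`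
`   + E (h (log(|u|+2)+2)/(τ√T) + h e^{τ/8}/(τT²) + h/(τ³T²))`. [cite: Titchmarsh1986, §9.26] -/
theorem main_pointwise : ∃ E : ℝ, 0 < E ∧ ∀ (T h τ u : ℝ), 200 ≤ T → 0 ≤ h → h ≤ 1 → 1 ≤ τ →
    u ∈ Set.Icc (9 * T / 8) (15 * T / 8) →
    |(primeV τ (u + h) - primeV τ u).re| ≤
      |∫ t in T..2 * T, kerDil τ (t - u) * (zetaArgS (t + h) - zetaArgS t)| +
      ‖∑' ρ : ZetaZeros.riemannZetaNontrivialZeros,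
          (riemannZetaZeroOrder (ρ : ℂ) : ℂ) * (offA τ ρ (u + h) - offA τ ρ u)‖ +
      E * (h * (Real.log (|u| + 2) + 2) / (τ * Real.sqrt T) + h * Real.exp (τ / 8) / (τ * T ^ 2) + h / (τ ^ 3 * T ^ 2)) := by
  obtain ⟨Crem, hCrem0, hCrem⟩ := exists_remainder_bound
  obtain ⟨C, hC0, hC⟩ := exists_kerDil_le
  obtain ⟨Cθ, hCθ0, hCθ⟩ := exists_abs_riemannSiegelThetaDeriv_le
  have hD := decayD0_nonneg
  refine ⟨Crem + 2 * decayD0 + 27040 * Cθ * C + 1, by positivity, ?_⟩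
  intro T h τ u hT hh hh1 hτ hu
  have hτ0 : 0 < τ := by linarith
  have hT0 : 0 < T := by linarith
  obtain ⟨hsumA, hrem⟩ := hCrem T h τ u hT hh hh1 hτ hu
  -- the pieces
  set A : ℂ → ℝ := fun ρ => ∫ t in u..u + h, kerDil τ (ρ.im - t) with hA
  set convN := ∫ t in T..2 * T, kerDil τ (t - u) * ((zetaZeroCount (t + h) : ℝ) - zetaZeroCount t) with hconvN
  set convθ := ∫ t in T..2 * T, kerDil τ (t - u) * (riemannSiegelTheta (t + h) - riemannSiegelTheta t) with hconvθ
  set X := ∑' ρ : ZetaZeros.riemannZetaNontrivialZeros, (riemannZetaZeroOrder (ρ : ℂ) : ℝ) * A ρ with hX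
  -- (i) counting side
  have hN : convN = ∑ ρ ∈ (zetaZeroBox_finite 0 (2 * T + h)).toFinset, (riemannZetaZeroOrder ρ : ℝ) *
      ∫ t in T..2 * T, kerDil τ (t - u) * Set.indicator (Set.Ico (ρ.im - h) ρ.im) (fun _ => (1 : ℝ)) t :=
    integral_kerDil_mul_deltaN_eq_sum τ u hT0.le hh
  have hr₁ : |X - convN| ≤ Crem * h * (Real.log (|u| + 2) + 2) / (τ * Real.sqrt T) := by rw [hN]; exact hrem
  -- (ii) the explicit formula, split into the window part and the off-line part
  have hEF := integrated_explicit_formula hτ0 u h hh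
  have hsumAc : Summable fun ρ : ZetaZeros.riemannZetaNontrivialZeros =>
      (((riemannZetaZeroOrder (ρ : ℂ) : ℝ) * A ρ : ℝ) : ℂ) := Complex.summable_ofReal.2 hsumA
  have hsumB := summable_offA_sub hτ u h
  have hsplit : ∀ ρ : ZetaZeros.riemannZetaNontrivialZeros,
      (riemannZetaZeroOrder (ρ : ℂ) : ℂ) * ((∫ t in u..u + h, (kerDil τ ((ρ : ℂ).im - t) : ℂ)) + (offA τ ρ (u + h) - offA τ ρ u)) =
      (((riemannZetaZeroOrder (ρ : ℂ) : ℝ) * A ρ : ℝ) : ℂ) + (riemannZetaZeroOrder (ρ : ℂ) : ℂ) * (offA τ ρ (u + h) - offA τ ρ u) := by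
    intro ρ
    rw [intervalIntegral.integral_ofReal, hA]
    push_cast; ring
  rw [tsum_congr hsplit, hsumAc.tsum_add hsumB] at hEF
  -- (iii) real parts
  have hre := congrArg Complex.re hEF
  rw [Complex.add_re, Complex.re_tsum hsumAc] at hre
  simp only [Complex.ofReal_re] at hre
  rw [← hX] at hre
  -- the archimedean term is real and equals `(1/π) ∫ K Δθ`
  have hΘ : (∫ t in u..u + h, ((((1 / π) * ∫ v : ℝ, kerDil τ (v - t) * riemannSiegelThetaDeriv v : ℝ)) : ℂ)).re =
      (1 / π) * ∫ w : ℝ, kerDil τ (w - u) * (riemannSiegelTheta (w + h) - riemannSiegelTheta w) := by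
    rw [intervalIntegral.integral_ofReal, Complex.ofReal_re, intervalIntegral.integral_const_mul,
      integral_integral_kerDil_thetaDeriv_eq hτ u hh hh1]
  have htail := theta_tail_bound hCθ0.le hCθ hC hC0.le hT hh hh1 hτ hu
  rw [← hconvθ] at htail
  -- (iv) counting side of `S`
  have hS := conv_deltaS_eq τ u T h
  rw [← hconvN, ← hconvθ] at hS
  -- (v) polar bound
  have hpol := norm_integral_polar_le hτ hT0 (by linarith [hu.1] : T ≤ u) hh
  -- (vi) assemble: `Re Δ𝒱 = Re POL − convS + tail/π − (X − convN) − Re D`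
  set P := (∫ t in u..u + h, (weilMellin (gDil τ) (-(t * I)) + weilMellin (gDil τ) (1 - t * I))) with hP
  set Dc := ∑' ρ : ZetaZeros.riemannZetaNontrivialZeros,
      (riemannZetaZeroOrder (ρ : ℂ) : ℂ) * (offA τ ρ (u + h) - offA τ ρ u) with hDc
  set V := primeV τ (u + h) - primeV τ u with hV
  set full := ∫ w : ℝ, kerDil τ (w - u) * (riemannSiegelTheta (w + h) - riemannSiegelTheta w) with hfull
  have hre' : X + Dc.re = P.re - V.re + (1 / π) * full := by
    rw [← hΘ]
    have := hre
    simp only [Complex.sub_re, Complex.add_re] at this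
    linarith
  have hVeq : V.re = P.re - (∫ t in T..2 * T, kerDil τ (t - u) * (zetaArgS (t + h) - zetaArgS t)) +
      (1 / π) * (full - convθ) - (X - convN) - Dc.re := by
    rw [hS]; linarith
  -- bounds
  have hπ1 : (1 : ℝ) ≤ π := by linarith [Real.pi_gt_three]
  have h1 : |P.re| ≤ 2 * h * Real.exp (τ / 8) * decayD0 / (τ * T ^ 2) := (abs_re_le_norm P).trans hpol
  have h2 : |Dc.re| ≤ ‖Dc‖ := abs_re_le_norm Dc
  have h3 : |(1 / π) * (full - convθ)| ≤ 27040 * h * Cθ * C / (τ ^ 3 * T ^ 2) := by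
    rw [abs_mul, abs_of_pos (by positivity)]
    calc 1 / π * |full - convθ| ≤ 1 * |full - convθ| := by
          refine mul_le_mul_of_nonneg_right ?_ (abs_nonneg _)
          rw [div_le_one Real.pi_pos]; exact hπ1
      _ ≤ _ := by rw [one_mul]; exact htail
  have hmain : |V.re| ≤ |P.re| + |∫ t in T..2 * T, kerDil τ (t - u) * (zetaArgS (t + h) - zetaArgS t)| +
      |(1 / π) * (full - convθ)| + |X - convN| + |Dc.re| := by
    rw [hVeq]
    have e : ∀ a b c d e : ℝ, |a - b + c - d - e| ≤ |a| + |b| + |c| + |d| + |e| := by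
      intro a b c d e
      calc |a - b + c - d - e| ≤ |a - b + c - d| + |e| := abs_sub _ _
        _ ≤ |a - b + c| + |d| + |e| := by linarith [abs_sub (a - b + c) d]
        _ ≤ |a - b| + |c| + |d| + |e| := by linarith [abs_add_le (a - b) c]
        _ ≤ |a| + |b| + |c| + |d| + |e| := by linarith [abs_sub a b]
    exact e _ _ _ _ _
  -- the error budget
  have herr : |P.re| + |(1 / π) * (full - convθ)| + |X - convN| ≤
      (Crem + 2 * decayD0 + 27040 * Cθ * C + 1) *
        (h * (Real.log (|u| + 2) + 2) / (τ * Real.sqrt T) + h * Real.exp (τ / 8) / (τ * T ^ 2) + h / (τ ^ 3 * T ^ 2)) := by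
    have hlog : 0 ≤ Real.log (|u| + 2) := Real.log_nonneg (by linarith [abs_nonneg u])
    have ha : 0 ≤ h * (Real.log (|u| + 2) + 2) / (τ * Real.sqrt T) := by positivity
    have hb : 0 ≤ h * Real.exp (τ / 8) / (τ * T ^ 2) := by positivity
    have hc : 0 ≤ h / (τ ^ 3 * T ^ 2) := by positivity
    have e1 : Crem * h * (Real.log (|u| + 2) + 2) / (τ * Real.sqrt T) = Crem * (h * (Real.log (|u| + 2) + 2) / (τ * Real.sqrt T)) := by ring
    have e2 : 2 * h * Real.exp (τ / 8) * decayD0 / (τ * T ^ 2) = (2 * decayD0) * (h * Real.exp (τ / 8) / (τ * T ^ 2)) := by ring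
    have e3 : 27040 * h * Cθ * C / (τ ^ 3 * T ^ 2) = (27040 * Cθ * C) * (h / (τ ^ 3 * T ^ 2)) := by ring
    rw [e1] at hr₁; rw [e2] at h1; rw [e3] at h3
    have hCθC : 0 ≤ 27040 * Cθ * C := by positivity
    nlinarith [mul_nonneg hCrem0.le hb, mul_nonneg hCrem0.le hc, mul_nonneg hD ha, mul_nonneg hD hc,
      mul_nonneg hCθC ha, mul_nonneg hCθC hb]
  linarith

end Literature.NumberTheory.LFunctions.SelbergDelta
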